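import Mathlib
import HarnessLib
import Summits.ValiantsHypothesis.ValiantsHypothesis.Theorems.LacunarySymmetroidMatrixDescartesOsculationLawRankLetterCard
import Summits.ValiantsHypothesis.ValiantsHypothesis.Theorems.LacunarySymmetroidMatrixDescartesOsculationLawRankLetterRealRoots

/-!
# ValiantsHypothesis / LacunarySymmetroid — crux `MatrixDescartes` (stmt-ValiantsHypothesis-18050, V1),
# line «osculation-law»: the letter of a symmetric pencil SPLITS AT EVERY ABSCISSA (grouped coefficients)

Glue between `…RankLetterCard` (the rank-`r` letter as `Σ_k X₁^k ι a_k`, `a_k = Σ_{|U|=k} det G[U := unit rows]`)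
and `…RankLetterRealRoots` (symmetric letters split): for a symmetric block pencil on `Fin r ⊕ Fin s` and every
real `t`, the real polynomial `Σ_k C(a_k(t)) X^k` is the letter polynomial `det(C(G(t)) + X·C(I_r ⊕ 0))` of the
evaluated (symmetric) matrix `G(t)` (`letter_poly_at`), hence SPLITS over `ℝ` (`splits_letter_at`) — with no
assumption on `a_r(t)`.  Consequence used by the degenerate branches of the columns: when the top coefficient
vanishes identically at rank three (`a₃ = det G₂₂ ≡ 0`), the remaining quadratic letter `a₂b² + a₁b + a₀` has
`4a₂(t)a₀(t) ≤ a₁(t)²` for every `t` (`hdisc_of_top_zero_three`).  Honest framing: bookkeeping only; nothing here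
bears on `OsculationLaw`, `MatrixDescartes`, Conjecture B or `VP ≠ VNP`.  No definitions, no named facts.
-/

-- `Summit.ValiantsHypothesis.ValiantsHypothesis.…` is the tree's mandated single-conjunct layout (Sub = Summit).
set_option linter.dupNamespace false

noncomputable section

namespace Summit.ValiantsHypothesis.ValiantsHypothesis.Theorems.LacunarySymmetroidMatrixDescartes

namespace OsculationLetter

open Polynomial
open scoped BigOperators

/-- A principal cofactor of the evaluated pencil is the evaluated principal cofactor. [folklore] -/
theorem det_unitRows_eval {ι : Type*} [Fintype ι] [DecidableEq ι] {K : ℕ} (d : Fin K → ℕ)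
    (T : Fin K → Matrix ι ι ℝ) (U : Finset ι) (t : ℝ) :
    (Matrix.of fun i j : ι => if i ∈ U then (Pi.single i (1 : ℝ) : ι → ℝ) j
        else ((∑ l, (X : ℝ[X]) ^ d l • (T l).map Polynomial.C).map (Polynomial.eval t)) i j).det =
      ((Matrix.of fun i j : ι => if i ∈ U then (Pi.single i (1 : ℝ[X]) : ι → ℝ[X]) j
        else (∑ l, (X : ℝ[X]) ^ d l • (T l).map Polynomial.C) i j).det).eval t := by
  rw [← Polynomial.coe_evalRingHom, RingHom.map_det, RingHom.mapMatrix_apply,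
    unitRows_map _ _ (map_zero _) (map_one _)]

/-- **The letter polynomial at an abscissa.**  `det(C(G(t)) + X·C(I_r ⊕ 0)) = Σ_{k ≤ r} C(a_k(t)) · X^k`. [folklore] -/
theorem letter_poly_at (r s : ℕ) {K : ℕ} (d : Fin K → ℕ) (S : Fin K → Matrix (Fin r ⊕ Fin s) (Fin r ⊕ Fin s) ℝ)
    (t : ℝ) :
    Matrix.det (((∑ l, (X : ℝ[X]) ^ d l • (S l).map Polynomial.C).map (Polynomial.eval t)).map Polynomial.C
      + (X : ℝ[X]) • (Matrix.fromBlocks 1 0 0 0 : Matrix (Fin r ⊕ Fin s) (Fin r ⊕ Fin s) ℝ).map Polynomial.C) =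
      ∑ k ∈ Finset.range (r + 1), (X : ℝ[X]) ^ k * Polynomial.C
        ((∑ U ∈ (Finset.univ.map Function.Embedding.inl : Finset (Fin r ⊕ Fin s)).powersetCard k,
          (Matrix.of fun i j : Fin r ⊕ Fin s => if i ∈ U then (Pi.single i (1 : ℝ[X]) : Fin r ⊕ Fin s → ℝ[X]) j
            else (∑ l, (X : ℝ[X]) ^ d l • (S l).map Polynomial.C) i j).det).eval t) := by
  rw [blockProj_map_gen r s (Polynomial.C.map_zero) (Polynomial.C.map_one), ← indicator_inl_eq_blockProj r s,
    det_add_smul_indicator, sum_powerset_pow_card, card_inl]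
  refine Finset.sum_congr rfl fun k _ => ?_
  rw [eval_finsetSum, map_sum]
  congr 1
  refine Finset.sum_congr rfl fun U _ => ?_
  rw [← unitRows_map ((∑ l, (X : ℝ[X]) ^ d l • (S l).map Polynomial.C).map (Polynomial.eval t)) U
      (map_zero (Polynomial.C : ℝ →+* ℝ[X])) (map_one (Polynomial.C : ℝ →+* ℝ[X])),
    ← RingHom.mapMatrix_apply, ← RingHom.map_det, det_unitRows_eval]

/-- **The letter splits at every abscissa** (symmetric block pencil; no assumption on the top coefficient).
[folklore] -/
theorem splits_letter_at (r s : ℕ) {K : ℕ} (d : Fin K → ℕ) (S : Fin K → Matrix (Fin r ⊕ Fin s) (Fin r ⊕ Fin s) ℝ)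
    (hS : ∀ l, (S l).IsSymm) (t : ℝ) :
    (∑ k ∈ Finset.range (r + 1), (X : ℝ[X]) ^ k * Polynomial.C
        ((∑ U ∈ (Finset.univ.map Function.Embedding.inl : Finset (Fin r ⊕ Fin s)).powersetCard k,
          (Matrix.of fun i j : Fin r ⊕ Fin s => if i ∈ U then (Pi.single i (1 : ℝ[X]) : Fin r ⊕ Fin s → ℝ[X]) j
            else (∑ l, (X : ℝ[X]) ^ d l • (S l).map Polynomial.C) i j).det).eval t)).Splits := by
  rw [← letter_poly_at]
  have hGt : ((∑ l, (X : ℝ[X]) ^ d l • (S l).map Polynomial.C).map (Polynomial.eval t)).IsSymm := by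
    have := (OsculationRankTwo.pencil_isSymm d S hS).map (Polynomial.eval t)
    exact this
  exact splits_det_add_X_smul_blockProj r s _ hGt

/-! ### Rank three with vanishing top coefficient: the quadratic letter is real-rooted -/

/-- At rank three, if `a₃ = det G₂₂ ≡ 0` then `4·a₂(t)·a₀(t) ≤ a₁(t)²` for every `t` (the surviving quadratic letter
splits). [folklore] -/
theorem hdisc_of_top_zero_three (s : ℕ) {K : ℕ} (d : Fin K → ℕ) (S : Fin K → Matrix (Fin 3 ⊕ Fin s) (Fin 3 ⊕ Fin s) ℝ)
    (hS : ∀ l, (S l).IsSymm)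
    (h3 : (∑ l, (X : ℝ[X]) ^ d l • ((S l).toBlocks₂₂).map Polynomial.C).det = 0) (t : ℝ) :
    4 * ((∑ U ∈ (Finset.univ.map Function.Embedding.inl : Finset (Fin 3 ⊕ Fin s)).powersetCard 2,
          (Matrix.of fun i j : Fin 3 ⊕ Fin s => if i ∈ U then (Pi.single i (1 : ℝ[X]) : Fin 3 ⊕ Fin s → ℝ[X]) j
            else (∑ l, (X : ℝ[X]) ^ d l • (S l).map Polynomial.C) i j).det).eval t *
        ((∑ l, (X : ℝ[X]) ^ d l • (S l).map Polynomial.C).det).eval t) ≤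
      (∑ U ∈ (Finset.univ.map Function.Embedding.inl : Finset (Fin 3 ⊕ Fin s)).powersetCard 1,
          (Matrix.of fun i j : Fin 3 ⊕ Fin s => if i ∈ U then (Pi.single i (1 : ℝ[X]) : Fin 3 ⊕ Fin s → ℝ[X]) j
            else (∑ l, (X : ℝ[X]) ^ d l • (S l).map Polynomial.C) i j).det).eval t ^ 2 := by
  have hsp := splits_letter_at 3 s d S hS t
  rw [Finset.sum_range_succ, Finset.sum_range_succ, Finset.sum_range_succ, Finset.sum_range_succ,
    Finset.sum_range_zero, zero_add, coeff_top 3 s d S, coeff_zero 3 s d S, h3, eval_zero, map_zero, mul_zero,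
    add_zero] at hsp
  -- `hsp`: `X^0·C a₀ + X^1·C a₁ + X^2·C a₂` splits
  by_cases ha2 : (∑ U ∈ (Finset.univ.map Function.Embedding.inl : Finset (Fin 3 ⊕ Fin s)).powersetCard 2,
      (Matrix.of fun i j : Fin 3 ⊕ Fin s => if i ∈ U then (Pi.single i (1 : ℝ[X]) : Fin 3 ⊕ Fin s → ℝ[X]) j
        else (∑ l, (X : ℝ[X]) ^ d l • (S l).map Polynomial.C) i j).det).eval t = 0
  · rw [ha2, zero_mul, mul_zero]; exact sq_nonneg _
  · refine discrim_nonneg_of_splits _ _ _ ha2 ?_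
    convert hsp using 1
    rw [pow_zero, one_mul, pow_one]
    ring

end OsculationLetter

end Summit.ValiantsHypothesis.ValiantsHypothesis.Theorems.LacunarySymmetroidMatrixDescartes
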